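import Mathlib
import Literature.AlgebraicGeometry.Tropical.InitialIdeal
import Literature.AlgebraicGeometry.Tropical.SchonIdeal
import Literature.AlgebraicGeometry.Tropical.TropicalLink
import Summits.ResolutionOfSingularities.ResolutionOfSingularities.Theorems.TropicalLinksInductiveStepRayFibre
import Summits.ResolutionOfSingularities.ResolutionOfSingularities.Theorems.TropicalLinksInductiveStepStratumChartRegular

/-!
# TropicalLinks / InductiveStep — schön from Luxton–Qu stratum charts (roadmap brick H, the algebraic
# capstone)

Route `ResolutionOfSingularities/TropicalLinks`, crux `InductiveStep` (stmt-ResolutionOfSingularities-17233),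
line `split`, in support of stub `stub_sncClosureSchon`.  Combining the dictionary's capstone (B8,
`tropicalLinks_isSchonIdeal_iff_forall_rayFibre`: schön ⟺ regular + all ray fibres regular) with the
local-to-global interface (G, `tropicalLinks_forall_prime_regular_rayFibre_of_stratumChart`: a stratum
chart makes the ray fibre regular):

* `tropicalLinks_isSchonIdeal_of_stratumCharts` (registered brick H) — **if `V(I) ⊆ 𝔾_m^n` is regular and
  for every lattice splitting `e : ℤ^n ≃+ ℤ × K` either the ray fibre ring of `e·I` is trivial (the ray
  misses the tropical variety) or a Luxton–Qu stratum chart for `e·I` exists, then `I` is schön.**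

This is the ALGEBRAIC form of Luxton–Qu Prop. 3.1 / Tevelev 2007 Thm. 1.4 through the Gröbner
dictionary, with LQ's fan condition (3) not needed.  What remains of `stub_sncClosureSchon` after it is
geometric: construct the charts (and the emptiness of the off-support fibres) from the stub's datum
(regular projective closure with snc hyperplane at infinity) — generic hyperplane sections (Bertini),
units with prescribed orders along the boundary (Pic bookkeeping), properness for the valuative step.
No new definitions.
-/

-- single-problem summit: the doubled namespace component `ResolutionOfSingularities` is forced
set_option linter.dupNamespace false

namespace Summit.ResolutionOfSingularities.ResolutionOfSingularities.Theorems

open AddMonoidAlgebra Literature.AlgebraicGeometry.Tropical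

/-- **Schön from stratum charts** (registered brick H, the algebraic capstone of the roadmap for
`stub_sncClosureSchon`): regularity of `V(I)` plus, at every ray, either an empty fibre or a Luxton–Qu
stratum chart, implies `IsSchonIdeal I`. [folklore] -/
theorem tropicalLinks_isSchonIdeal_of_stratumCharts :
    ∀ (k : Type) [Field k] (n : ℕ) (I : Ideal (AddMonoidAlgebra k (Fin n → ℤ))), (∀ (P : Ideal (AddMonoidAlgebra k (Fin n → ℤ) ⧸ I)) [P.IsPrime], IsRegularLocalRing (Localization.AtPrime P)) → (∀ (K : Type) [AddCommGroup K] (e : (Fin n → ℤ) ≃+ ℤ × K), Subsingleton (AddMonoidAlgebra k K ⧸ Literature.AlgebraicGeometry.Tropical.linkIdeal (AddMonoidHom.inr ℕ K) (Literature.AlgebraicGeometry.Tropical.linkIdeal ((Nat.castAddMonoidHom ℤ).prodMap (AddMonoidHom.id K)) (I.map (AddMonoidAlgebra.domCongr k k e)) ⊔ Ideal.span {AddMonoidAlgebra.single ((1 : ℕ), (0 : K)) (1 : k)})) ∨ (∃ (A : Type) (_ : CommRing A) (_ : Algebra k A) (ιA : A →ₐ[k] AddMonoidAlgebra k (ℤ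 × K) ⧸ I.map (AddMonoidAlgebra.domCongr k k e)) (l : ℕ) (m : Fin l → A) (b : Fin l → ℕ) (a : (ℤ × K) →+ (Fin l → ℤ)), Function.Injective ιA ∧ (∀ y : AddMonoidAlgebra k (ℤ × K) ⧸ I.map (AddMonoidAlgebra.domCongr k k e), ∃ (x : A) (n : ℕ), y * ιA (∏ i, m i) ^ n = ιA x) ∧ (∀ i, 0 < b i) ∧ Function.Surjective a ∧ (∀ w : ℤ × K, w.1 = ∑ i, (b i : ℤ) * a w i) ∧ (∀ w : ℤ × K, ∃ ε : Aˣ, Ideal.Quotient.mk (I.map (AddMonoidAlgebra.domCongr k k e)) (AddMonoidAlgebra.single w (1 : k)) * ιA (∏ i, m i ^ (-(a w i)).toNat) = ιA ((ε : A) * ∏ i, m i ^ (a w i).toNat)) ∧ ιA.range = Algebra.adjoin k {x : AddMonoidAlgebra k (ℤ × K) ⧸ I.map (AddMonoidAlgebra.domCongr k k e) | ∃ w : ℤ × K, (∀ i, 0 ≤ a w i) ∧ x = Ideal.Quotient.mk (I.map (AddMonoidAlgebra.domCongr k k e)) (AddMonoidAlgebra.single w (1 : k))} ∧ (∀ (i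 : Fin l) (T : Set (Fin l)), i ∉ T → ∀ y : A, m i * y ∈ Ideal.span (m '' T) → y ∈ Ideal.span (m '' T)) ∧ IsNoetherianRing A ∧ (∀ (P : Ideal (A ⧸ Ideal.span (Set.range m))) [P.IsPrime], IsRegularLocalRing (Localization.AtPrime P)))) → Literature.AlgebraicGeometry.Tropical.IsSchonIdeal I := by
  intro k _ n I h0 hcharts
  refine (tropicalLinks_isSchonIdeal_iff_forall_rayFibre k n I).2 ⟨h0, fun K _ e P hP => ?_⟩
  rcases hcharts K e with hsub | ⟨A, _, _, ιA, l, m, b, a, hinj, hloc, hb, hsurj, hρ, hmon, hgen, hperm, hN, hreg⟩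
  · exact absurd (Subsingleton.elim _ _) hP.ne_top
  · exact tropicalLinks_forall_prime_regular_rayFibre_of_stratumChart k K (I.map (AddMonoidAlgebra.domCongr k k e))
      A ιA l m b a hinj hloc hb hsurj hρ hmon hgen hperm hN hreg P

end Summit.ResolutionOfSingularities.ResolutionOfSingularities.Theorems
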